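import Summits.QuantumFields.BalabanUV.Beta.SymAveragingMixedJetWords

/-!
# `BalabanUV.Beta.SymAveragingMixedJetTables` — part 2: slot-by-slot vanishing of the symmetrised jets, THE SCALAR TABLES
# `symATab ∕ symApTab ∕ symTTab ∕ symVh2Tab` by word-coefficient extraction, their support, block covariance and finiteness

HONEST FRAMING (cell contract, verbatim): «discharging `BetaPertH` makes Bałaban's UV stability UNCONDITIONAL — a real constructive-QFT
result; it is NOT the continuum limit and NOT the Clay problem.»  THIS MODULE DISCHARGES NOTHING of `BetaPertH` ∕ row D1: [folklore] letter
algebra, the `S_d × S_d` version of node 12b `Beta.AveragingMixedJetTables` §5–§6 (same statements, same proofs, `PhiGAt ↦ symPhiGAt`; node 12b's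
path algebra `UT`, matrix units `E`, `single_off`, `shift_upF`, `nearSet`, `bondSet`, `near_zero_iff`, `sh_neg_sh` and killing-letter lemmas BY NAME).
0 sorry, 0 `def … : Prop`, nothing cited as a fact.  NOT D1, NOT BetaPertH, NOT continuum, NOT Clay.

WHAT ([folklore] throughout):
* §5 the three killing homomorphisms on node 12's chart through `map_symPhiGAt`: `symQjetAt ρ 0 B B′ = 0`, `c11 (symQjetAt ρ (upF W) 0 B′) = 0`,
  `c11 (symQjetAt ρ (upF W) B 0) = 0`, hence `symT2At` and `symMjetAt` VANISH when a slot vanishes on node 7a's support box `Near L y`.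
* §6 THE SYMMETRISED SCALAR TABLES in node 12b's path algebra `UT = Matrix (Fin 4) (Fin 4) ℚ`: `symATab` (word `W_f V_{f′} B_g` of `symMjetAt`),
  `symApTab` (word `W_f B_g V_{f′}`), the diagonal recipe `symTTab := a + a′ − a∘swap`, and `symVh2Tab` (word `B_g B′_h W_f` of `symT2At`) — the
  (0.4) counterparts of node 12b's `aTab ∕ apTab ∕ tTab ∕ vh2Tab` (engine of record: an1's exact (0.4) tier-2 engine, OUTSIDE Lean; provenance only —
  NOTHING about any value is asserted here).
* §7 SUPPORT (every bond argument must be based in the support box, for a root offset in the box), BLOCK COVARIANCE (all roots), reduction to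
  the reference block, and FINITENESS: the reference-block absolute sums `symMixAbs ρ L`, `symVh2Abs ρ L` (instances of the honest finite constant
  `tripleAbs`) dominate every entry (`abs_symTTab_le`, `abs_symVh2Tab_le`).
NOT HERE: the packed kernels and their letters (part 3), any value, any Ward law, any estimate beyond finiteness.
HONEST DEPENDENCY (verbatim): «continuum YM on T⁴ ⇐ BetaPertH ∧ nine spine estimates (0/9 proved); BetaPertH ⇐ (D1) ∧ (D4) ∧ CAP+tail;
G-an2-4 gates asym, D1 and NE2/3/4.»  ABSOLUTE RULE (cell, verbatim): «No internally-minted statement may enter as a cited fact. Every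
hypothesis is either kernel-proved in this package or a verbatim quotation of a PUBLISHED theorem with page reference.»
Provenance: β sub-cell, W-supplier `b2b-balaban-beta-an1` gen 43 (scratch for courier by the row-D1 owner), 2026-08-21; no existing file touched.
-/

namespace Summit.QuantumFields.BalabanUV.Beta.SymAveragingMixedJetTables

open Finset
open scoped BigOperators
open Literature.MathematicalPhysics.QuantumFieldTheory.Balaban1983to89.Beta
open Literature.MathematicalPhysics.QuantumFieldTheory.Balaban1983to89.Beta.AffineAveraging
open Literature.MathematicalPhysics.QuantumFieldTheory.Balaban1983to89.Beta.AveragingContours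
open Literature.MathematicalPhysics.QuantumFieldTheory.Balaban1983to89.Beta.AveragingContoursRooted
open Literature.MathematicalPhysics.QuantumFieldTheory.Balaban1983to89.Beta.TransportedContourVariables
open Literature.MathematicalPhysics.QuantumFieldTheory.Balaban1983to89.Beta.AveragingHessianKernels
open Literature.MathematicalPhysics.QuantumFieldTheory.Balaban1983to89.Beta.AveragingHessianKernelsRooted
open Literature.MathematicalPhysics.QuantumFieldTheory.Balaban1983to89.Beta.AveragingThirdJet
open Literature.MathematicalPhysics.QuantumFieldTheory.Balaban1983to89.Beta.AveragingThirdJet.Tau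
open Literature.MathematicalPhysics.QuantumFieldTheory.Balaban1983to89.Beta.AveragingMixedJetTables

noncomputable section

variable {d : ℕ}

/-! ## §5 Vanishing of the symmetrised jets slot by slot (node 12's chart) -/

section QjetVanishing

variable (𝕜 : Type*) [Field 𝕜] {𝔸 : Type*} [Ring 𝔸] [Algebra 𝕜 𝔸]

/-- [folklore] Killing `σ` on the symmetrised rooted averaging (node 12's chart) kills the fluctuation letter. -/
theorem kσ_symPhiRAt (ρ : Fin d → ℤ) (ω : Form1 d (Tau 𝔸)) (B B' : Form1 d 𝔸) (L : ℕ) (μ : Fin d) (y : Fin d → ℤ) :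
    kσ 𝕜 (symPhiRAt 𝕜 ρ ω B B' L μ y) = symPhiRAt 𝕜 ρ 0 B B' L μ y := by
  rw [symPhiRAt, symPhiRAt, map_symPhiGAt]; simp only [kσ_Gf, kσ_Gb]; try rfl

/-- [folklore] **The symmetrised rooted jet VANISHES without fluctuation**: `symQjetAt ρ 0 B B′ = 0`. -/
theorem symQjetAt_ω_zero (ρ : Fin d → ℤ) (B B' : Form1 d 𝔸) (L : ℕ) (μ : Fin d) (y : Fin d → ℤ) :
    symQjetAt 𝕜 ρ 0 B B' L μ y = 0 := by
  have e := congrArg TrivSqZeroExt.snd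
    (map_logT (kσ 𝕜) (symPhiRAt 𝕜 ρ 0 B B' L μ y * invT (symPhiRAt 𝕜 ρ 0 B B' L μ y)))
  simp only [map_mul, map_invT, kσ_symPhiRAt] at e
  rw [kσ_apply, snd_dmk] at e
  rw [symQjetAt]; exact e.symm

/-- [folklore] Killing `τ₁` on the symmetrised rooted averaging (scalar fluctuation) kills `B`. -/
theorem k1_symPhiRAt_upF (ρ : Fin d → ℤ) (W B B' : Form1 d 𝔸) (L : ℕ) (μ : Fin d) (y : Fin d → ℤ) :
    mapDual (k1 𝕜) (symPhiRAt 𝕜 ρ (upF W) B B' L μ y) = symPhiRAt 𝕜 ρ (upF W) 0 B' L μ y := by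
  rw [symPhiRAt, symPhiRAt, map_symPhiGAt]; simp only [k1_Gf_upF, k1_Gb_upF]; try rfl

/-- [folklore] Killing `τ₁` on the pure-background symmetrised rooted averaging kills `B`. -/
theorem k1_symPhiRAt_zero (ρ : Fin d → ℤ) (B B' : Form1 d 𝔸) (L : ℕ) (μ : Fin d) (y : Fin d → ℤ) :
    mapDual (k1 𝕜) (symPhiRAt 𝕜 ρ 0 B B' L μ y) = symPhiRAt 𝕜 ρ 0 0 B' L μ y := by
  rw [symPhiRAt, symPhiRAt, map_symPhiGAt]; simp only [k1_Gf_zero, k1_Gb_zero]; try rfl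

/-- [folklore] Killing `τ₂` on the symmetrised rooted averaging (scalar fluctuation) kills `B′`. -/
theorem k2_symPhiRAt_upF (ρ : Fin d → ℤ) (W B B' : Form1 d 𝔸) (L : ℕ) (μ : Fin d) (y : Fin d → ℤ) :
    mapDual (k2 𝕜) (symPhiRAt 𝕜 ρ (upF W) B B' L μ y) = symPhiRAt 𝕜 ρ (upF W) B 0 L μ y := by
  rw [symPhiRAt, symPhiRAt, map_symPhiGAt]; simp only [k2_Gf_upF, k2_Gb_upF]; try rfl

/-- [folklore] Killing `τ₂` on the pure-background symmetrised rooted averaging kills `B′`. -/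
theorem k2_symPhiRAt_zero (ρ : Fin d → ℤ) (B B' : Form1 d 𝔸) (L : ℕ) (μ : Fin d) (y : Fin d → ℤ) :
    mapDual (k2 𝕜) (symPhiRAt 𝕜 ρ 0 B B' L μ y) = symPhiRAt 𝕜 ρ 0 B 0 L μ y := by
  rw [symPhiRAt, symPhiRAt, map_symPhiGAt]; simp only [k2_Gf_zero, k2_Gb_zero]; try rfl

/-- [folklore] **The `τ₁τ₂`-component of the symmetrised rooted jet VANISHES without the first background.** -/
theorem c11_symQjetAt_B_zero (ρ : Fin d → ℤ) (W B' : Form1 d 𝔸) (L : ℕ) (μ : Fin d) (y : Fin d → ℤ) :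
    c11 (symQjetAt 𝕜 ρ (upF W) 0 B' L μ y) = 0 := by
  have e := congrArg (fun Z : Rho 𝔸 => c11 Z.snd)
    (map_logT (mapDual (k1 𝕜)) (symPhiRAt 𝕜 ρ (upF W) 0 B' L μ y * invT (symPhiRAt 𝕜 ρ 0 0 B' L μ y)))
  simp only [map_mul, map_invT, k1_symPhiRAt_upF, k1_symPhiRAt_zero, snd_mapDual, c11_k1] at e
  rw [symQjetAt]; exact e.symm

/-- [folklore] **The `τ₁τ₂`-component of the symmetrised rooted jet VANISHES without the second background.** -/
theorem c11_symQjetAt_B'_zero (ρ : Fin d → ℤ) (W B : Form1 d 𝔸) (L : ℕ) (μ : Fin d) (y : Fin d → ℤ) :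
    c11 (symQjetAt 𝕜 ρ (upF W) B 0 L μ y) = 0 := by
  have e := congrArg (fun Z : Rho 𝔸 => c11 Z.snd)
    (map_logT (mapDual (k2 𝕜)) (symPhiRAt 𝕜 ρ (upF W) B 0 L μ y * invT (symPhiRAt 𝕜 ρ 0 B 0 L μ y)))
  simp only [map_mul, map_invT, k2_symPhiRAt_upF, k2_symPhiRAt_zero, snd_mapDual, c11_k2] at e
  rw [symQjetAt]; exact e.symm

/-- [folklore] `symT2At` vanishes without fluctuation. -/
theorem symT2At_ω_zero (ρ : Fin d → ℤ) (B B' : Form1 d 𝔸) (L : ℕ) (μ : Fin d) (y : Fin d → ℤ) :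
    symT2At 𝕜 ρ 0 B B' L μ y = 0 := by
  rw [symT2At, symQjetAt_ω_zero, symQjetAt_ω_zero, c11_zero, add_zero]

/-- [folklore] `symT2At` (scalar fluctuation) vanishes without the first background. -/
theorem symT2At_B_zero (ρ : Fin d → ℤ) (W B' : Form1 d 𝔸) (L : ℕ) (μ : Fin d) (y : Fin d → ℤ) :
    symT2At 𝕜 ρ (upF W) 0 B' L μ y = 0 := by
  rw [symT2At, c11_symQjetAt_B_zero, c11_symQjetAt_B'_zero, add_zero]

/-- [folklore] `symT2At` (scalar fluctuation) vanishes without the second background. -/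
theorem symT2At_B'_zero (ρ : Fin d → ℤ) (W B : Form1 d 𝔸) (L : ℕ) (μ : Fin d) (y : Fin d → ℤ) :
    symT2At 𝕜 ρ (upF W) B 0 L μ y = 0 := by
  rw [symT2At, c11_symQjetAt_B'_zero, c11_symQjetAt_B_zero, add_zero]

/-- [folklore] The symmetrised mixed jet vanishes when the first fluctuation vanishes on the support box. -/
theorem symMjetAt_W_off {r : Fin d → ℕ} {L : ℕ} (hr : r ∈ box d L) {μ : Fin d} {y : Fin d → ℤ} {W : Form1 d 𝔸}
    (hW : ∀ κ x, Near L y x → W κ x = 0) (V B : Form1 d 𝔸) : symMjetAt 𝕜 (toSite r) W V B L μ y = 0 :=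
  (symMjetAt_congr_near 𝕜 hr μ y (W' := 0) hW (fun _ _ _ => rfl) (fun _ _ _ => rfl)).trans (symMjetAt_W_zero 𝕜 _ V B L μ y)

/-- [folklore] The symmetrised mixed jet vanishes when the second fluctuation vanishes on the support box. -/
theorem symMjetAt_V_off {r : Fin d → ℕ} {L : ℕ} (hr : r ∈ box d L) {μ : Fin d} {y : Fin d → ℤ} (W : Form1 d 𝔸) {V : Form1 d 𝔸}
    (hV : ∀ κ x, Near L y x → V κ x = 0) (B : Form1 d 𝔸) : symMjetAt 𝕜 (toSite r) W V B L μ y = 0 :=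
  (symMjetAt_congr_near 𝕜 hr μ y (V' := 0) (fun _ _ _ => rfl) hV (fun _ _ _ => rfl)).trans (symMjetAt_V_zero 𝕜 _ W B L μ y)

/-- [folklore] The symmetrised mixed jet vanishes when the background vanishes on the support box. -/
theorem symMjetAt_B_off {r : Fin d → ℕ} {L : ℕ} (hr : r ∈ box d L) {μ : Fin d} {y : Fin d → ℤ} (W V : Form1 d 𝔸) {B : Form1 d 𝔸}
    (hB : ∀ κ x, Near L y x → B κ x = 0) : symMjetAt 𝕜 (toSite r) W V B L μ y = 0 :=
  (symMjetAt_congr_near 𝕜 hr μ y (B' := 0) (fun _ _ _ => rfl) (fun _ _ _ => rfl) hB).trans (symMjetAt_B_zero 𝕜 _ W V L μ y)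

/-- [folklore] `symT2At` vanishes when the (scalar) fluctuation vanishes on the support box. -/
theorem symT2At_W_off {r : Fin d → ℕ} {L : ℕ} (hr : r ∈ box d L) {μ : Fin d} {y : Fin d → ℤ} {W : Form1 d 𝔸}
    (hW : ∀ κ x, Near L y x → W κ x = 0) (B B' : Form1 d 𝔸) : symT2At 𝕜 (toSite r) (upF W) B B' L μ y = 0 :=
  (symT2At_congr_near 𝕜 hr μ y (ω' := 0) (fun κ x hx => by simp [hW κ x hx]) (fun _ _ _ => rfl) (fun _ _ _ => rfl)).trans
    (symT2At_ω_zero 𝕜 _ B B' L μ y)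

/-- [folklore] `symT2At` vanishes when the first background vanishes on the support box. -/
theorem symT2At_B_off {r : Fin d → ℕ} {L : ℕ} (hr : r ∈ box d L) {μ : Fin d} {y : Fin d → ℤ} (W : Form1 d 𝔸) {B : Form1 d 𝔸}
    (hB : ∀ κ x, Near L y x → B κ x = 0) (B' : Form1 d 𝔸) : symT2At 𝕜 (toSite r) (upF W) B B' L μ y = 0 :=
  (symT2At_congr_near 𝕜 hr μ y (B₁ := 0) (fun _ _ _ => rfl) hB (fun _ _ _ => rfl)).trans (symT2At_B_zero 𝕜 _ W B' L μ y)

/-- [folklore] `symT2At` vanishes when the second background vanishes on the support box. -/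
theorem symT2At_B'_off {r : Fin d → ℕ} {L : ℕ} (hr : r ∈ box d L) {μ : Fin d} {y : Fin d → ℤ} (W B : Form1 d 𝔸) {B' : Form1 d 𝔸}
    (hB' : ∀ κ x, Near L y x → B' κ x = 0) : symT2At 𝕜 (toSite r) (upF W) B B' L μ y = 0 :=
  (symT2At_congr_near 𝕜 hr μ y (B₁' := 0) (fun _ _ _ => rfl) (fun _ _ _ => rfl) hB').trans (symT2At_B'_zero 𝕜 _ W B L μ y)

end QjetVanishing

/-! ## §6 The symmetrised scalar tables by word-coefficient extraction in node 12b's path algebra `UT` -/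

section Tables

/-- [folklore] TABLE `a_sym(f, g, f′)`: the coefficient of the word `W_f V_{f′} B_g` in `M^{ρ,sym}_b(W, V; B)` (sym twin of `aTab`). -/
def symATab (ρ : Fin d → ℤ) (L : ℕ) (μ : Fin d) (y : Fin d → ℤ) (f g f' : Bond d) : ℚ :=
  symMjetAt ℚ ρ (single f (E 0 1)) (single f' (E 1 2)) (single g (E 2 3)) L μ y 0 3

/-- [folklore] TABLE `a′_sym(f, g, f′)`: the coefficient of the word `W_f B_g V_{f′}` in `M^{ρ,sym}_b(W, V; B)` (sym twin of `apTab`). -/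
def symApTab (ρ : Fin d → ℤ) (L : ℕ) (μ : Fin d) (y : Fin d → ℤ) (f g f' : Bond d) : ℚ :=
  symMjetAt ℚ ρ (single f (E 0 1)) (single f' (E 2 3)) (single g (E 1 2)) L μ y 0 3

/-- [folklore] THE DIAGONAL RECIPE `t_sym(f, f′; g) := a_sym(f,g,f′) + a′_sym(f,g,f′) − a_sym(f′,g,f)` (sym twin of `tTab`; provenance only —
nothing about the values is asserted here). -/
def symTTab (ρ : Fin d → ℤ) (L : ℕ) (μ : Fin d) (y : Fin d → ℤ) (f f' g : Bond d) : ℚ :=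
  symATab ρ L μ y f g f' + symApTab ρ L μ y f g f' - symATab ρ L μ y f' g f

/-- [folklore] TABLE `s_sym(f; g, h)`: the coefficient of the word `B_g B′_h W_f` in `symT2At` (sym twin of `vh2Tab`; the other Hall coefficient
is `s_sym(f; h, g)` by `symT2At_symm`). -/
def symVh2Tab (ρ : Fin d → ℤ) (L : ℕ) (μ : Fin d) (y : Fin d → ℤ) (f g h : Bond d) : ℚ :=
  symT2At ℚ ρ (upF (single f (E 2 3))) (single g (E 0 1)) (single h (E 1 2)) L μ y 0 3

end Tables

/-! ## §7 Support, block covariance and finiteness of the symmetrised tables -/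

section Structure

variable {r : Fin d → ℕ} {L : ℕ}

/-- [folklore] `a_sym(f,g,f′) = 0` unless `f` is based in the support box. -/
theorem symATab_eq_zero₁ (hr : r ∈ box d L) (μ : Fin d) (y : Fin d → ℤ) {f : Bond d} (h : ¬ Near L y f.2) (g f' : Bond d) :
    symATab (toSite r) L μ y f g f' = 0 := by
  rw [symATab, symMjetAt_W_off ℚ hr (single_off h _)]; rfl

/-- [folklore] `a_sym(f,g,f′) = 0` unless `g` is based in the support box. -/
theorem symATab_eq_zero₂ (hr : r ∈ box d L) (μ : Fin d) (y : Fin d → ℤ) (f : Bond d) {g : Bond d} (h : ¬ Near L y g.2) (f' : Bond d) :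
    symATab (toSite r) L μ y f g f' = 0 := by
  rw [symATab, symMjetAt_B_off ℚ hr _ _ (single_off h _)]; rfl

/-- [folklore] `a_sym(f,g,f′) = 0` unless `f′` is based in the support box. -/
theorem symATab_eq_zero₃ (hr : r ∈ box d L) (μ : Fin d) (y : Fin d → ℤ) (f g : Bond d) {f' : Bond d} (h : ¬ Near L y f'.2) :
    symATab (toSite r) L μ y f g f' = 0 := by
  rw [symATab, symMjetAt_V_off ℚ hr _ (single_off h _)]; rfl

/-- [folklore] `a′_sym(f,g,f′) = 0` unless `f` is based in the support box. -/
theorem symApTab_eq_zero₁ (hr : r ∈ box d L) (μ : Fin d) (y : Fin d → ℤ) {f : Bond d} (h : ¬ Near L y f.2) (g f' : Bond d) :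
    symApTab (toSite r) L μ y f g f' = 0 := by
  rw [symApTab, symMjetAt_W_off ℚ hr (single_off h _)]; rfl

/-- [folklore] `a′_sym(f,g,f′) = 0` unless `g` is based in the support box. -/
theorem symApTab_eq_zero₂ (hr : r ∈ box d L) (μ : Fin d) (y : Fin d → ℤ) (f : Bond d) {g : Bond d} (h : ¬ Near L y g.2) (f' : Bond d) :
    symApTab (toSite r) L μ y f g f' = 0 := by
  rw [symApTab, symMjetAt_B_off ℚ hr _ _ (single_off h _)]; rfl

/-- [folklore] `a′_sym(f,g,f′) = 0` unless `f′` is based in the support box. -/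
theorem symApTab_eq_zero₃ (hr : r ∈ box d L) (μ : Fin d) (y : Fin d → ℤ) (f g : Bond d) {f' : Bond d} (h : ¬ Near L y f'.2) :
    symApTab (toSite r) L μ y f g f' = 0 := by
  rw [symApTab, symMjetAt_V_off ℚ hr _ (single_off h _)]; rfl

/-- [folklore] `t_sym(f,f′;g) = 0` unless `f` is based in the support box. -/
theorem symTTab_eq_zero₁ (hr : r ∈ box d L) (μ : Fin d) (y : Fin d → ℤ) {f : Bond d} (h : ¬ Near L y f.2) (f' g : Bond d) :
    symTTab (toSite r) L μ y f f' g = 0 := by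
  rw [symTTab, symATab_eq_zero₁ hr μ y h, symApTab_eq_zero₁ hr μ y h, symATab_eq_zero₃ hr μ y _ _ h]; ring

/-- [folklore] `t_sym(f,f′;g) = 0` unless `f′` is based in the support box. -/
theorem symTTab_eq_zero₂ (hr : r ∈ box d L) (μ : Fin d) (y : Fin d → ℤ) (f : Bond d) {f' : Bond d} (h : ¬ Near L y f'.2) (g : Bond d) :
    symTTab (toSite r) L μ y f f' g = 0 := by
  rw [symTTab, symATab_eq_zero₃ hr μ y _ _ h, symApTab_eq_zero₃ hr μ y _ _ h, symATab_eq_zero₁ hr μ y h]; ring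

/-- [folklore] `t_sym(f,f′;g) = 0` unless `g` is based in the support box. -/
theorem symTTab_eq_zero₃ (hr : r ∈ box d L) (μ : Fin d) (y : Fin d → ℤ) (f f' : Bond d) {g : Bond d} (h : ¬ Near L y g.2) :
    symTTab (toSite r) L μ y f f' g = 0 := by
  rw [symTTab, symATab_eq_zero₂ hr μ y _ h, symApTab_eq_zero₂ hr μ y _ h, symATab_eq_zero₂ hr μ y _ h]; ring

/-- [folklore] `s_sym(f;g,h) = 0` unless `f` is based in the support box. -/
theorem symVh2Tab_eq_zero₁ (hr : r ∈ box d L) (μ : Fin d) (y : Fin d → ℤ) {f : Bond d} (h : ¬ Near L y f.2) (g h' : Bond d) :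
    symVh2Tab (toSite r) L μ y f g h' = 0 := by
  rw [symVh2Tab, symT2At_W_off ℚ hr (single_off h _)]; rfl

/-- [folklore] `s_sym(f;g,h) = 0` unless `g` is based in the support box. -/
theorem symVh2Tab_eq_zero₂ (hr : r ∈ box d L) (μ : Fin d) (y : Fin d → ℤ) (f : Bond d) {g : Bond d} (h : ¬ Near L y g.2) (h' : Bond d) :
    symVh2Tab (toSite r) L μ y f g h' = 0 := by
  rw [symVh2Tab, symT2At_B_off ℚ hr _ (single_off h _)]; rfl

/-- [folklore] `s_sym(f;g,h) = 0` unless `h` is based in the support box. -/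
theorem symVh2Tab_eq_zero₃ (hr : r ∈ box d L) (μ : Fin d) (y : Fin d → ℤ) (f g : Bond d) {h' : Bond d} (h : ¬ Near L y h'.2) :
    symVh2Tab (toSite r) L μ y f g h' = 0 := by
  rw [symVh2Tab, symT2At_B'_off ℚ hr _ _ (single_off h _)]; rfl

/-- [folklore] BLOCK COVARIANCE of `a_sym` (all roots). -/
theorem symATab_add (ρ : Fin d → ℤ) (L : ℕ) (μ : Fin d) (y t : Fin d → ℤ) (f g f' : Bond d) :
    symATab ρ L μ (y + t) (f.sh ((L : ℤ) • t)) (g.sh ((L : ℤ) • t)) (f'.sh ((L : ℤ) • t)) = symATab ρ L μ y f g f' := by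
  rw [symATab, symATab, symMjetAt_add, shift_single, shift_single, shift_single]

/-- [folklore] BLOCK COVARIANCE of `a′_sym`. -/
theorem symApTab_add (ρ : Fin d → ℤ) (L : ℕ) (μ : Fin d) (y t : Fin d → ℤ) (f g f' : Bond d) :
    symApTab ρ L μ (y + t) (f.sh ((L : ℤ) • t)) (g.sh ((L : ℤ) • t)) (f'.sh ((L : ℤ) • t)) = symApTab ρ L μ y f g f' := by
  rw [symApTab, symApTab, symMjetAt_add, shift_single, shift_single, shift_single]

/-- [folklore] BLOCK COVARIANCE of `t_sym`. -/
theorem symTTab_add (ρ : Fin d → ℤ) (L : ℕ) (μ : Fin d) (y t : Fin d → ℤ) (f f' g : Bond d) :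
    symTTab ρ L μ (y + t) (f.sh ((L : ℤ) • t)) (f'.sh ((L : ℤ) • t)) (g.sh ((L : ℤ) • t)) = symTTab ρ L μ y f f' g := by
  rw [symTTab, symTTab, symATab_add, symApTab_add, symATab_add]

/-- [folklore] BLOCK COVARIANCE of `s_sym`. -/
theorem symVh2Tab_add (ρ : Fin d → ℤ) (L : ℕ) (μ : Fin d) (y t : Fin d → ℤ) (f g h : Bond d) :
    symVh2Tab ρ L μ (y + t) (f.sh ((L : ℤ) • t)) (g.sh ((L : ℤ) • t)) (h.sh ((L : ℤ) • t)) = symVh2Tab ρ L μ y f g h := by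
  rw [symVh2Tab, symVh2Tab, symT2At_add, shift_upF, shift_single, shift_single, shift_single]

/-- [folklore] `t_sym` at the block `y` is `t_sym` at the block `0` on the back-shifted bonds. -/
theorem symTTab_eq_zero_block (ρ : Fin d → ℤ) (L : ℕ) (μ : Fin d) (y : Fin d → ℤ) (f f' g : Bond d) :
    symTTab ρ L μ y f f' g = symTTab ρ L μ 0 (f.sh (-((L : ℤ) • y))) (f'.sh (-((L : ℤ) • y))) (g.sh (-((L : ℤ) • y))) := by
  have h := symTTab_add ρ L μ 0 y (f.sh (-((L : ℤ) • y))) (f'.sh (-((L : ℤ) • y))) (g.sh (-((L : ℤ) • y)))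
  rw [zero_add, sh_neg_sh, sh_neg_sh, sh_neg_sh] at h
  exact h

/-- [folklore] `s_sym` at the block `y` is `s_sym` at the block `0` on the back-shifted bonds. -/
theorem symVh2Tab_eq_zero_block (ρ : Fin d → ℤ) (L : ℕ) (μ : Fin d) (y : Fin d → ℤ) (f g h : Bond d) :
    symVh2Tab ρ L μ y f g h = symVh2Tab ρ L μ 0 (f.sh (-((L : ℤ) • y))) (g.sh (-((L : ℤ) • y))) (h.sh (-((L : ℤ) • y))) := by
  have e := symVh2Tab_add ρ L μ 0 y (f.sh (-((L : ℤ) • y))) (g.sh (-((L : ℤ) • y))) (h.sh (-((L : ℤ) • y)))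
  rw [zero_add, sh_neg_sh, sh_neg_sh, sh_neg_sh] at e
  exact e

/-- [our object] THE REFERENCE-BLOCK ABSOLUTE SUM of a three-bond rational table: `Σ_μ Σ_{p,q,r ∈ box bonds} |T μ p q r|` (an honest, finite
constant; no closed form is claimed). -/
def tripleAbs (L : ℕ) (T : Fin d → Bond d → Bond d → Bond d → ℚ) : ℝ :=
  ∑ μ : Fin d, ∑ p ∈ (bondSet d L ×ˢ bondSet d L) ×ˢ bondSet d L, |(T μ p.1.1 p.1.2 p.2 : ℝ)|

/-- [folklore] `0 ≤ tripleAbs`. -/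
theorem tripleAbs_nonneg (L : ℕ) (T : Fin d → Bond d → Bond d → Bond d → ℚ) : 0 ≤ tripleAbs L T :=
  Finset.sum_nonneg fun _ _ => Finset.sum_nonneg fun _ _ => abs_nonneg _

/-- [folklore] Every reference-block entry is dominated by `tripleAbs`. -/
theorem le_tripleAbs (L : ℕ) (T : Fin d → Bond d → Bond d → Bond d → ℚ) (μ : Fin d) {p : (Bond d × Bond d) × Bond d}
    (hp : p ∈ (bondSet d L ×ˢ bondSet d L) ×ˢ bondSet d L) : |(T μ p.1.1 p.1.2 p.2 : ℝ)| ≤ tripleAbs L T := by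
  have h1 : |(T μ p.1.1 p.1.2 p.2 : ℝ)| ≤ ∑ q ∈ (bondSet d L ×ˢ bondSet d L) ×ˢ bondSet d L, |(T μ q.1.1 q.1.2 q.2 : ℝ)| :=
    Finset.single_le_sum (f := fun q : (Bond d × Bond d) × Bond d => |(T μ q.1.1 q.1.2 q.2 : ℝ)|) (fun _ _ => abs_nonneg _) hp
  refine h1.trans ?_
  rw [tripleAbs]
  exact Finset.single_le_sum (f := fun ν : Fin d => ∑ q ∈ (bondSet d L ×ˢ bondSet d L) ×ˢ bondSet d L, |(T ν q.1.1 q.1.2 q.2 : ℝ)|)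
    (fun _ _ => Finset.sum_nonneg fun _ _ => abs_nonneg _) (Finset.mem_univ μ)

/-- [our object] THE REFERENCE-BLOCK ABSOLUTE SUM of the symmetrised mixed table `t_sym` (sym twin of `mixAbs`). -/
def symMixAbs (ρ : Fin d → ℤ) (L : ℕ) : ℝ := tripleAbs L fun μ f f' g => symTTab ρ L μ 0 f f' g

/-- [our object] THE REFERENCE-BLOCK ABSOLUTE SUM of the symmetrised `T₂` table `s_sym` (sym twin of `vh2Abs`). -/
def symVh2Abs (ρ : Fin d → ℤ) (L : ℕ) : ℝ := tripleAbs L fun μ f g h => symVh2Tab ρ L μ 0 f g h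

/-- [folklore] `0 ≤ symMixAbs`. -/
theorem symMixAbs_nonneg (ρ : Fin d → ℤ) (L : ℕ) : 0 ≤ symMixAbs ρ L := tripleAbs_nonneg _ _

/-- [folklore] `0 ≤ symVh2Abs`. -/
theorem symVh2Abs_nonneg (ρ : Fin d → ℤ) (L : ℕ) : 0 ≤ symVh2Abs ρ L := tripleAbs_nonneg _ _

/-- [folklore] **FINITE RANGE + UNIFORM BOUND of the symmetrised mixed table** (root offset in the box). -/
theorem abs_symTTab_le (hr : r ∈ box d L) (μ : Fin d) (y : Fin d → ℤ) (f f' g : Bond d) :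
    |(symTTab (toSite r) L μ y f f' g : ℝ)| ≤ symMixAbs (toSite r) L := by
  by_cases hf : Near L y f.2
  · by_cases hf' : Near L y f'.2
    · by_cases hg : Near L y g.2
      · have hmem : ((f.sh (-((L : ℤ) • y)), f'.sh (-((L : ℤ) • y))), g.sh (-((L : ℤ) • y))) ∈ (bondSet d L ×ˢ bondSet d L) ×ˢ bondSet d L := by
          simp only [Finset.mem_product, mem_bondSet, Bond.sh_snd]
          exact ⟨⟨near_zero_iff.2 hf, near_zero_iff.2 hf'⟩, near_zero_iff.2 hg⟩
        have k := le_tripleAbs L (fun ν p q s => symTTab (toSite r) L ν 0 p q s) μ hmem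
        rw [← symTTab_eq_zero_block] at k
        exact k
      · rw [symTTab_eq_zero₃ hr μ y _ _ hg, Rat.cast_zero, abs_zero]; exact symMixAbs_nonneg _ _
    · rw [symTTab_eq_zero₂ hr μ y _ hf', Rat.cast_zero, abs_zero]; exact symMixAbs_nonneg _ _
  · rw [symTTab_eq_zero₁ hr μ y hf, Rat.cast_zero, abs_zero]; exact symMixAbs_nonneg _ _

/-- [folklore] **FINITE RANGE + UNIFORM BOUND of the symmetrised `T₂` table** (root offset in the box). -/
theorem abs_symVh2Tab_le (hr : r ∈ box d L) (μ : Fin d) (y : Fin d → ℤ) (f g h : Bond d) :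
    |(symVh2Tab (toSite r) L μ y f g h : ℝ)| ≤ symVh2Abs (toSite r) L := by
  by_cases hf : Near L y f.2
  · by_cases hg : Near L y g.2
    · by_cases hh : Near L y h.2
      · have hmem : ((f.sh (-((L : ℤ) • y)), g.sh (-((L : ℤ) • y))), h.sh (-((L : ℤ) • y))) ∈ (bondSet d L ×ˢ bondSet d L) ×ˢ bondSet d L := by
          simp only [Finset.mem_product, mem_bondSet, Bond.sh_snd]
          exact ⟨⟨near_zero_iff.2 hf, near_zero_iff.2 hg⟩, near_zero_iff.2 hh⟩
        have k := le_tripleAbs L (fun ν p q s => symVh2Tab (toSite r) L ν 0 p q s) μ hmem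
        rw [← symVh2Tab_eq_zero_block] at k
        exact k
      · rw [symVh2Tab_eq_zero₃ hr μ y _ _ hh, Rat.cast_zero, abs_zero]; exact symVh2Abs_nonneg _ _
    · rw [symVh2Tab_eq_zero₂ hr μ y _ hg, Rat.cast_zero, abs_zero]; exact symVh2Abs_nonneg _ _
  · rw [symVh2Tab_eq_zero₁ hr μ y hf, Rat.cast_zero, abs_zero]; exact symVh2Abs_nonneg _ _

end Structure

end

end Summit.QuantumFields.BalabanUV.Beta.SymAveragingMixedJetTables
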